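import Literature.MathematicalPhysics.QuantumFieldTheory.Balaban1983to89.T3MinimiserStabilityReduction
import Literature.MathematicalPhysics.QuantumFieldTheory.Balaban1983to89.T3PrintedRegularMinimiser
import Literature.MathematicalPhysics.QuantumFieldTheory.Balaban1983to89.T3OrbitAverage
import Literature.MathematicalPhysics.QuantumFieldTheory.Balaban1983to89.B12ContinuousTransportInvariance
import Literature.MathematicalPhysics.QuantumFieldTheory.Balaban1983to89.Node00.CanonicalTransportOfRecord
import Literature.MathematicalPhysics.QuantumFieldTheory.Balaban1983to89.T3InteriorExcision
import Summits.QuantumFields.YangMills.Theorems.FluctuationComparisonRegPrIntLSupTailReduction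
import Summits.QuantumFields.YangMills.Theorems.FluctuationComparisonRegPrIntLSupTailDepthInduction
import Summits.QuantumFields.YangMills.Theorems.FluctuationComparisonRegPrIntLWreg
import HarnessLib

/-!
# LINE g22-2 «persistence_floor» — THE STOPPED PERSISTENCE CHAIN: the good-history floor POS∘ from ONE-LEVEL INTERIOR PERSISTENCE and the multi-step tails
# (ideator `ym-r3-idea-1` g22, LENS «control»; companion of LINE g22-1 `Lines/multistep_odds.lean`)

Crux of record: `stmt-QuantumFields-20520` = `Summit.QuantumFields.YangMills.Theses.UnitScaleTilt.FluctuationComparisonRegPrIntL`.  Target concluded BY NAME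
here: this file's `GoodHistoryPositiveIntCan` (POS∘) — the text of LINE g22-1 `Lines/multistep_odds.lean` §2 (l.322–339) BYTE-IDENTICAL (as are MSTEP∘ ∕ MSTEP₁∘ ∕
DEEPSTEP∘ and the §3 analysis lemmas and doors), so that in any file seeing both declarations the bridge is `Iff.rfl`; g22-1's PROVED `largeFieldFourPtInt_of_rows :
1L4ᶜ∘ → H4ᶜ∘ → CRUDELOC → MSTEP₁∘ → DEEPSTEP∘ → POS∘ → LFR♯ᶜ∘` then carries it to LFR♯ᶜ∘, interior_table to S2β, the registry to the crux.  With this file the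
stub POS∘ of g22-1 is REPLACED by one new row PERS₁∘ plus the two tail rows g22-1 already carries, so the organ LFR♯ᶜ∘ rests on 1L4ᶜ∘, H4ᶜ∘, CRUDELOC, MSTEP₁∘,
DEEPSTEP∘, PERS₁∘.  The registry is FROZEN (RULING №36∕37∕39): PUBLISHED organ-level line, NOT registered; no `skeleton check` from this seat.

THE LEVER (lens «control» — a STOPPING LEVEL).  POS∘ asks, for each window level `J`, a `K`-uniform floor `q_J > 0` of the conditional probability of a good
`b₀`-history given an interior level-`J` event.  The naive chaining of per-level good-probabilities given a GOOD (full-window) history is R3-FLIN-exposed at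
L = 3, 5 (POS∘'s own docstring; g22-1 card: the interior fraction cancels between consecutive levels).  The way out is to chain a DIFFERENT one-level quantity
and to STOP: (i) PERS₁∘ — INTERIOR-TO-INTERIOR one-level persistence, `q_J·Gibbs_K(D_{J,K}⁻¹B) ≤ Gibbs_K(D_{J,K}⁻¹B ∩ D_{J+1,K}⁻¹W_{J+1}(c·b₀))` for interior `B`,
with `q_J > 0` chosen AFTER `J` (positivity, no rate, no uniformity in `J` — so the R3-FLIN boundary layer costs a `β_{J+1}`-power in `q_J`, which is allowed;
the content is uniformity in the run length `K`, i.e. UV stability of the one-step conditional law [Balaban1985UV3] (7)); chained over the levels `J, …, J+k₀−1`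
it lands the run in the INTERIOR window at level `J + k₀` with conditional probability `≥ Π q_i` (FILE J's re-basing ✓`runningEvent_eq_preimage`, inequality
reversed — PROVED §4 `persist_chain`); (ii) the STOPPING LEVEL `k₀ = k₀(F, γ, J)`: the first depth at which the super-polynomial tail `σ_{J+k₀} = Σ_{j > J+k₀} s_j`
of MSTEP∘ is `≤ ½` (exists because `s` is summable; it depends on `F` because the torus exponent `F.m` is free — exactly why POS∘ had to be a row); above it
MSTEP∘, re-applied AT LEVEL `J + k₀` to the re-based interior event, bounds the bad levels by `½` of the mass (g22-1's union bound ✓`badHistory_le_sum`), so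
`q_J^{POS} := ½·Π_{i<k₀} min(q_{J+i}, 1)` serves for every `K` (for `K ≤ J + k₀` the chain alone does).  The controlling move is the choice of the level at which
one switches from POSITIVITY (finite depth, coarse lattices, `β_j` small) to SMALLNESS (deep levels) — the two regimes that no single uniform constant serves.

THE LINE.  POS∘ ⟸ (PROVED §4–§5) PERS₁∘ `OneLevelPersistenceIntCan` (NEW) + MSTEP∘ `MultiStepTailIntCan`; MSTEP∘ ⟸ (door PROVED, g22-1 verbatim) MSTEP₁∘
`OneStepTailIntCan` + DEEPSTEP∘ `DeepStepTailIntCan` (both g22-1's rows, verbatim — shared stubs, not re-planned).  STUBS (3, §6): MSTEP₁∘, DEEPSTEP∘ (shared with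
g22-1), PERS₁∘ (NEW).  Unique concluder `goodHistoryPositiveIntCan_of_stubs : GoodHistoryPositiveIntCan`.  `lean check`: rc 0, sorries = the 3 stubs, 0 elsewhere.

HONEST STATUS.  Nothing of Bałaban's is asserted; R3-FLIN ∕ FL-B ∕ FL-N are toy letters (GUIDANCE); PERS₁∘ ∕ MSTEP₁∘ ∕ DEEPSTEP∘ ∕ POS∘ ∕ LFR♯ᶜ∘ ∕ S2β ∕ 20520 are
NOT proved; `YM3TorusSU2` is NOT proved; rung R3 — NOT d = 4, NOT infinite volume, NOT a mass gap, NOT Clay; no summit is proved by a line.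
References: [Balaban1985UV3] (7) p.257, (38)–(41) p.266; [Balaban1985Averaging] (10) p.19, Prop. 1, §B (139)–(147) pp.39–40; [Balaban1985Variational] Thm 1
(8)–(10) p.279; [Balaban1989LargeFieldII] (1.77)–(1.79) p.383; [Balaban1987RG1] (0.11) p.253.
-/

open MeasureTheory Filter Topology Set
open scoped ENNReal NNReal BigOperators
open Literature.MathematicalPhysics.QuantumFieldTheory.Balaban1983to89
open Literature.MathematicalPhysics.QuantumFieldTheory.Balaban1983to89.T3ContinuumYM3Torus
open Literature.MathematicalPhysics.QuantumFieldTheory.Balaban1983to89.T3NestedUnitLaws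
open Literature.MathematicalPhysics.QuantumFieldTheory.Balaban1983to89.T3UnitLawDensityEML
open Literature.MathematicalPhysics.QuantumFieldTheory.Balaban1983to89.T3UnitScaleTilt
open Literature.MathematicalPhysics.QuantumFieldTheory.Balaban1983to89.T3TiltDescent
open Literature.MathematicalPhysics.QuantumFieldTheory.Balaban1983to89.T3PrintedRegularMinimiser
open Literature.MathematicalPhysics.QuantumFieldTheory.Balaban1983to89.T3ConstrainedMinimiser (fibre)
open Literature.MathematicalPhysics.QuantumFieldTheory.Balaban1983to89.T3LevelShift
open Literature.MathematicalPhysics.QuantumFieldTheory.Balaban1983to89.Missing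
open Literature.MathematicalPhysics.QuantumFieldTheory.Balaban1983to89.T4Continuum
open Literature.MathematicalPhysics.QuantumFieldTheory.Balaban1983to89.T3DescentFibreTower
open scoped Literature.MathematicalPhysics.QuantumFieldTheory.Balaban1983to89.T3OrbitAverage
open Literature.MathematicalPhysics.QuantumFieldTheory.Balaban1983to89.T3InteriorExcision (θBal_mul θBal_mul_le)
open Summit.QuantumFields.YangMills.Theorems.FluctuationComparisonRegPrIntLWregAssembly (isOpen_setOf_plaqSmall₂)
open Summit.QuantumFields.YangMills.Theorems.FluctuationComparisonRegPrIntLOddsLedgerVers (tower_eq_map_descendTo)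
open Summit.QuantumFields.YangMills.Theorems.FluctuationComparisonRegPrIntLSupTailReduction (le_on_of_ae_le heightDensityCan_le_of_setwise heightDensityCan_univ_eqOn)
open Summit.QuantumFields.YangMills.Theorems.FluctuationComparisonRegPrIntLSupTailDepthInduction (mem_histGood_iff_descendTo)

open Summit.QuantumFields.YangMills.Theorems.FluctuationComparisonRegPrIntLSupTailDepthInduction (runningEvent_zero runningEvent_eq_preimage)

noncomputable section

namespace Summit.QuantumFields.YangMills.Cruxes.FluctuationComparisonRegPrIntL.RunPairOrgan.PersistenceFloor

/-! ## §1 ROWS OF RECORD, VERBATIM (LINE g22-1 `Lines/multistep_odds.lean` §2): MSTEP∘, MSTEP₁∘, DEEPSTEP∘ and the TARGET POS∘ -/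

section Rows

variable (F : T3Family) (γ b₀ p₀ ε₀ : ℝ) {J K : ℕ} (hJK : J ≤ K)

/-- **MSTEP∘ · PER-LEVEL CONDITIONAL TAIL AFTER ONE INTERIOR CONDITIONING** (`MultiStepTailIntCan`): there is a super-polynomially small `s : ℕ → ℝ≥0` (chosen AFTER
`F, γ` — the torus exponent `F.m` is free, so only eventual smallness is asked) such that for every run `K`, every window level `J ≤ K`, every FREE level `J < j ≤ K`
and every measurable `B` inside the INTERIOR level-`J` window: `Gibbs_K(D_{J,K}⁻¹B ∩ {level j of the run leaves W_j(b₀)}) ≤ s_j·Gibbs_K(D_{J,K}⁻¹B)` — the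
conditional probability, given an interior level-`J` event, that the `(j − J)`-STEP constrained fluctuation above it has a `θ_j(b₀)`-large plaquette.  The mechanism:
the `(j−J)`-step background (iterated fibre minimiser) of an interior datum lies inside `W_j(b₀)` with room `≍ θ_j` (de-averaging ratio `C_{j−J}(L)∕L^{2(j−J)}`
against `L^{−(j−J)∕2}`), and the fluctuation around it is sub-Gaussian at scale `β_j^{−1∕2} ≪ θ_j`; entropy `Vol_j` is beaten by `e^{−cβ_jθ_j²} = e^{−c′L^j p(g_j)²∕…}`
for `j` large, whence super-polynomial `s`.  PROVED below from MSTEP₁∘ (`j = J+1`) and DEEPSTEP∘ (`j ≥ J+2`).  WHY IT MIGHT FAIL: through its two halves.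
[cite: Balaban1985UV3, (38)-(40) p.266; Balaban1985Averaging, (10) p.19 and Prop. 1; Balaban1985Variational, Thm 1 (9)-(10) p.279] -/
def MultiStepTailIntCan : Prop :=
  ∀ (L : ℕ), ∃ c₀ : ℝ, 0 < c₀ ∧ c₀ ≤ 1 ∧ ∀ (c : ℝ), 0 < c → c ≤ c₀ → ∃ pS : ℝ, ∀ (b₀ p₀ : ℝ), 0 < b₀ → pS ≤ p₀ → 0 < p₀ →
    ∃ γ₁ : ℝ, 0 < γ₁ ∧ ∀ (F : T3Family) (γ : ℝ), F.L = L → 0 < γ → γ ≤ γ₁ →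
      ∃ s : ℕ → ℝ, (∀ j, 0 ≤ s j) ∧ (∀ a : ℕ, Tendsto (fun j : ℕ => ((j : ℝ) + 1) ^ a * s j) atTop (𝓝 0)) ∧
        ∀ (J j K : ℕ) (hJK : J ≤ K) (hjK : j ≤ K), J < j →
          ∀ (B : Set (GaugeField (F.P J) 0 (Matrix.specialUnitaryGroup (Fin 2) ℂ))), MeasurableSet B →
            B ⊆ {U | PlaqSmall (θBal F.L γ (c * b₀) p₀ J) U} →
            gibbsK F ℰp γ K (descendTo F ℰp J K hJK ⁻¹' B ∩
                {V | ¬ PlaqSmall (θBal F.L γ b₀ p₀ j) (descendTo F ℰp j K hjK V)}) ≤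
              ENNReal.ofReal (s j) * gibbsK F ℰp γ K (descendTo F ℰp J K hJK ⁻¹' B)

/-- **MSTEP₁∘ · THE DEPTH-ONE ABSOLUTE TAIL — INTERIOR WINDOW, ALL RUNS, FAR FIELDS INCLUDED** (`OneStepTailIntCan`): MSTEP∘ at the first free level `j = J + 1`:
given an interior level-`J` event, the run's level `J + 1` leaves `W_{J+1}(b₀)` with conditional probability `≤ s_{J+1}`, uniformly in `K ≥ J + 1`.  On the interior
the good history is TYPICAL in the fibre, so the natural statement is ABSOLUTE (no division by the good-history mass): the re-typed home of MOD₁∘ (moderate fields,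
`Lines/tailsup_one.lean` §4e) AND of the suspended FAR₁ (critic #405 (A), decision (ii)); the moderate∕far split at a fixed `δ₀` is the hands' internal choice, served
by the LEAD's boxes D `…TailSupOneGaussianTail` (sub-Gaussian sup tail + union bound) and H `…TailSupOneFarPlaquetteCost` (`β_{J+1}(dist δ₀)²∕2` per far plaquette),
with E `…TailSupOneFibreRows` ∕ G `…ComparisonDoor` for the push-forward to the one-step fibre.  WHY IT MIGHT FAIL: the interior price — in the linearised toy the
fibre minimiser of an interior datum stays inside `W_{J+1}(b₀)` iff `c < c_max(L) = L^{3∕2}∕C(L)` (`0.602` at L = 3, `0.926` at L = 5; FL-B j337570∕j337675); the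
NONLINEAR SU(2) one-cell constant may differ by `O(θ²)` (instrument ASK (8)); and for `K > J + 1` the level-`(J+1)` marginal of the fibre measure is the one-step
fibre law tilted by the deeper effective density, whose flatness across `W_{J+1}` (WREG-type input) is used. [cite: Balaban1985UV3, (38)-(40) p.266;
Balaban1985Averaging, (10) p.19 and Prop. 1; Balaban1985Variational, Thm 1 (8)-(10) p.279] -/
def OneStepTailIntCan : Prop :=
  ∀ (L : ℕ), ∃ c₀ : ℝ, 0 < c₀ ∧ c₀ ≤ 1 ∧ ∀ (c : ℝ), 0 < c → c ≤ c₀ → ∃ pS : ℝ, ∀ (b₀ p₀ : ℝ), 0 < b₀ → pS ≤ p₀ → 0 < p₀ →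
    ∃ γ₁ : ℝ, 0 < γ₁ ∧ ∀ (F : T3Family) (γ : ℝ), F.L = L → 0 < γ → γ ≤ γ₁ →
      ∃ s : ℕ → ℝ, (∀ j, 0 ≤ s j) ∧ (∀ a : ℕ, Tendsto (fun j : ℕ => ((j : ℝ) + 1) ^ a * s j) atTop (𝓝 0)) ∧
        ∀ (J K : ℕ) (hJK : J + 1 ≤ K)
          (B : Set (GaugeField (F.P J) 0 (Matrix.specialUnitaryGroup (Fin 2) ℂ))), MeasurableSet B →
            B ⊆ {U | PlaqSmall (θBal F.L γ (c * b₀) p₀ J) U} →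
            gibbsK F ℰp γ K (descendTo F ℰp J K ((Nat.le_succ J).trans hJK) ⁻¹' B ∩
                {V | ¬ PlaqSmall (θBal F.L γ b₀ p₀ (J + 1)) (descendTo F ℰp (J + 1) K hJK V)}) ≤
              ENNReal.ofReal (s (J + 1)) * gibbsK F ℰp γ K (descendTo F ℰp J K ((Nat.le_succ J).trans hJK) ⁻¹' B)

/-- **DEEPSTEP∘ · THE MULTI-STEP TAILS `j ≥ J + 2` — INTERIOR WINDOW, ALL RUNS** (`DeepStepTailIntCan`): MSTEP∘ at the free levels two or more steps above the
window: the `k`-STEP (`k = j − J ≥ 2`) constrained fluctuation above an interior level-`J` event has a `θ_j(b₀)`-large plaquette with conditional probability `≤ s_j`.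
THE NEW OBJECT: the `k`-step de-averaging constant `C_k(L) := sup ‖ω ↦ d(k-step joint fibre minimiser)‖_{∞→∞}·L^{2k}` (linearised), conjecturally `≈ C(L^k) ≤ 15`
(R3-FLIN: `C(9) = 14.1`), to be compared with `L^{3k∕2}·Ππ` (`= 27` for `k = 2, L = 3`): the window ratio decays like `L^{−k∕2}` while the background's plaquettes decay
like `L^{−2k}` — the margin IMPROVES with depth and needs NO interior fraction from `k = 2` on.  WHY IT MIGHT FAIL: (i) if the iterated averaging `ℰp∘ℰp` is NOT the
block-`L²` averaging (composition defect of the printed `ℰp`), `C₂(3)` is a genuinely new number — instrument row R3-FLIN-2STEP (ASK, sealed prediction `C₂(3) ∈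
[11, 17]`; kill `≥ 27`); (ii) for `K > j` the level-`j` marginal of the fibre measure is tilted by the deeper effective density (WREG-type flatness used); (iii) the
uniformity in `k` of the sub-Gaussian constants (entropy `Vol_j` vs `e^{−cL^{j}…}`) is routine only once (i)–(ii) hold. [cite: Balaban1985Averaging, (10) p.19 and
Prop. 1; Balaban1985Variational, Thm 1 (9)-(10) p.279 and Prop. 7 p.299; Balaban1985UV3, (38)-(40) p.266] -/
def DeepStepTailIntCan : Prop :=
  ∀ (L : ℕ), ∃ c₀ : ℝ, 0 < c₀ ∧ c₀ ≤ 1 ∧ ∀ (c : ℝ), 0 < c → c ≤ c₀ → ∃ pS : ℝ, ∀ (b₀ p₀ : ℝ), 0 < b₀ → pS ≤ p₀ → 0 < p₀ →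
    ∃ γ₁ : ℝ, 0 < γ₁ ∧ ∀ (F : T3Family) (γ : ℝ), F.L = L → 0 < γ → γ ≤ γ₁ →
      ∃ s : ℕ → ℝ, (∀ j, 0 ≤ s j) ∧ (∀ a : ℕ, Tendsto (fun j : ℕ => ((j : ℝ) + 1) ^ a * s j) atTop (𝓝 0)) ∧
        ∀ (J j K : ℕ) (hJK : J ≤ K) (hjK : j ≤ K), J + 2 ≤ j →
          ∀ (B : Set (GaugeField (F.P J) 0 (Matrix.specialUnitaryGroup (Fin 2) ℂ))), MeasurableSet B →
            B ⊆ {U | PlaqSmall (θBal F.L γ (c * b₀) p₀ J) U} →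
            gibbsK F ℰp γ K (descendTo F ℰp J K hJK ⁻¹' B ∩
                {V | ¬ PlaqSmall (θBal F.L γ b₀ p₀ j) (descendTo F ℰp j K hjK V)}) ≤
              ENNReal.ofReal (s j) * gibbsK F ℰp γ K (descendTo F ℰp J K hJK ⁻¹' B)

/-- **POS∘ · A DEPTH-UNIFORM POSITIVE FLOOR OF THE GOOD-HISTORY ODDS GIVEN AN INTERIOR EVENT** (`GoodHistoryPositiveIntCan`): for every window level `J` there is
`q_J > 0` (chosen after `F, γ, J` — no rate asked) with `q_J·Gibbs_K(D_{J,K}⁻¹B) ≤ Gibbs_K(D_{J,K}⁻¹B ∩ histGood(b₀) K J)` for every run `K ≥ J` and every measurable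
`B` inside the interior window.  WHY A SEPARATE ROW: MSTEP∘'s `s` is only EVENTUALLY small (the torus exponent `F.m` is free after `γ₁`, so at small `j` the union bound
over `Vol_j` plaquettes exceeds 1); the content of POS∘ is DECOUPLING across levels (a product of per-level conditional good-probabilities, each bounded below
given the good history so far, times the super-polynomial tail for large `j`) — the inductive structure of Bałaban's small-field conditioning, not a union bound.
WHY IT MIGHT FAIL: the per-level conditional good-probability given a GOOD (not interior) history up to level `j−1` is again a full-window-uniform quantity at the
intermediate levels (R3-FLIN exposure of the naive chaining at L = 3, 5): the floor must come from the multi-step picture as well (DEEPSTEP∘'s mechanism at small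
`j`, with `β_j` small — the lattice is coarse there and positivity, not smallness, is asked). [cite: Balaban1985UV3, (7) p.257 and (38)-(40) p.266;
Balaban1989LargeFieldII, (1.77)-(1.79) p.383] -/
def GoodHistoryPositiveIntCan : Prop :=
  ∀ (L : ℕ), ∃ c₀ : ℝ, 0 < c₀ ∧ c₀ ≤ 1 ∧ ∀ (c : ℝ), 0 < c → c ≤ c₀ → ∃ pS : ℝ, ∀ (b₀ p₀ : ℝ), 0 < b₀ → pS ≤ p₀ → 0 < p₀ →
    ∃ γ₁ : ℝ, 0 < γ₁ ∧ ∀ (F : T3Family) (γ : ℝ), F.L = L → 0 < γ → γ ≤ γ₁ →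
      ∀ (J : ℕ), ∃ q : ℝ, 0 < q ∧ ∀ (K : ℕ) (hJK : J ≤ K)
        (B : Set (GaugeField (F.P J) 0 (Matrix.specialUnitaryGroup (Fin 2) ℂ))), MeasurableSet B →
          B ⊆ {U | PlaqSmall (θBal F.L γ (c * b₀) p₀ J) U} →
          ENNReal.ofReal q * gibbsK F ℰp γ K (descendTo F ℰp J K hJK ⁻¹' B) ≤
            gibbsK F ℰp γ K (descendTo F ℰp J K hJK ⁻¹' B ∩ histGood F ℰp (θBal F.L γ b₀ p₀) K J)


/-! ## §2 THE NEW ROW: PERS₁∘ — one-level INTERIOR-TO-INTERIOR persistence with a positive floor chosen after the level -/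

/-- **PERS₁∘ · ONE-LEVEL INTERIOR PERSISTENCE, POSITIVE FLOOR, ALL RUNS** (`OneLevelPersistenceIntCan`): for every window level `J` there is `q_J > 0` (chosen
AFTER `F, γ, J`: positivity, no rate, no uniformity in `J`) such that for every run `K ≥ J + 1` and every measurable `B` inside the INTERIOR level-`J` window
`W_J(c·b₀)`: `q_J·Gibbs_K(D_{J,K}⁻¹B) ≤ Gibbs_K(D_{J,K}⁻¹B ∩ D_{J+1,K}⁻¹ W_{J+1}(c·b₀))` — given an interior level-`J` event, the run's next level lies in ITS interior
window with conditional probability at least `q_J`, UNIFORMLY IN THE RUN LENGTH `K`.  The mechanism: the one-step background of an interior datum lies inside the full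
window `W_{J+1}(b₀)` (interior price `c < c_max(L)`, FL-B) but — at the edge of `W_J(c·b₀)` — at `≈ c·θ_{J+1}∕c_max(L)` OUTSIDE the level-`(J+1)` interior when
`c_max(L) < 1` (L = 3, 5): landing in the interior then costs a Gaussian fluctuation of relative size `1 − c_max`, i.e. `q_J ≍ β_{J+1}^{−κ}` — ALLOWED, since `q_J` is
chosen after `J`; what is asked uniformly is only the run length `K`, i.e. the UV stability of the conditional law of level `J+1` given level `J` as `K → ∞`
(Bałaban's effective densities at fixed height converge).  WHY IT MIGHT FAIL: (i) for `K > J + 1` the level-`(J+1)` marginal of the fibre measure is the one-step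
fibre law tilted by the deeper effective density `exp(−A_{J+1,K})`; a `K`-uniform LOWER bound of its mass on the interior fibre portion needs two-sided density
bounds at height `K − J − 1` on the SMALL-field region (UV stability (7) gives them; large-field contributions only help a lower bound if non-negative — they are);
(ii) the infimum over interior data `U` (conditioning on arbitrarily small `B`) needs continuity of the conditional law in `U` on the CLOSED interior window
(WREG-type regularity) — at the window's edge included. [cite: Balaban1985UV3, (7) p.257 and (38)-(40) p.266; Balaban1985Averaging, (10) p.19 and Prop. 1;
Balaban1985Variational, Thm 1 (8)-(10) p.279] -/
def OneLevelPersistenceIntCan : Prop :=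
  ∀ (L : ℕ), ∃ c₀ : ℝ, 0 < c₀ ∧ c₀ ≤ 1 ∧ ∀ (c : ℝ), 0 < c → c ≤ c₀ → ∃ pS : ℝ, ∀ (b₀ p₀ : ℝ), 0 < b₀ → pS ≤ p₀ → 0 < p₀ →
    ∃ γ₁ : ℝ, 0 < γ₁ ∧ ∀ (F : T3Family) (γ : ℝ), F.L = L → 0 < γ → γ ≤ γ₁ →
      ∀ (J : ℕ), ∃ q : ℝ, 0 < q ∧ ∀ (K : ℕ) (hJK : J + 1 ≤ K)
        (B : Set (GaugeField (F.P J) 0 (Matrix.specialUnitaryGroup (Fin 2) ℂ))), MeasurableSet B →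
          B ⊆ {U | PlaqSmall (θBal F.L γ (c * b₀) p₀ J) U} →
          ENNReal.ofReal q * gibbsK F ℰp γ K (descendTo F ℰp J K ((Nat.le_succ J).trans hJK) ⁻¹' B) ≤
            gibbsK F ℰp γ K (descendTo F ℰp J K ((Nat.le_succ J).trans hJK) ⁻¹' B ∩
              descendTo F ℰp (J + 1) K hJK ⁻¹' {V | PlaqSmall (θBal F.L γ (c * b₀) p₀ (J + 1)) V})

end Rows

/-! ## §3 VERBATIM FROM LINE g22-1 §3: super-polynomial tails, the door MSTEP₁∘ → DEEPSTEP∘ → MSTEP∘, the union bound over the free levels -/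

section Analysis

/-- A non-negative super-polynomially small sequence is bounded: `(j+1)^a s_j ≤ M`. [folklore] -/
theorem exists_bound_of_tendsto_zero {u : ℕ → ℝ} (hu0 : ∀ j, 0 ≤ u j) (hu : Tendsto u atTop (𝓝 0)) : ∃ M : ℝ, 0 ≤ M ∧ ∀ j, u j ≤ M := by
  obtain ⟨N, hN⟩ := eventually_atTop.1 (hu.eventually (gt_mem_nhds one_pos))
  refine ⟨1 + ∑ j ∈ Finset.range N, u j, add_nonneg zero_le_one (Finset.sum_nonneg fun i _ => hu0 i), fun j => ?_⟩
  by_cases hj : N ≤ j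
  · have := hN j hj
    have : 0 ≤ ∑ j ∈ Finset.range N, u j := Finset.sum_nonneg fun i _ => hu0 i
    linarith
  · have hjN : j ∈ Finset.range N := Finset.mem_range.2 (lt_of_not_ge hj)
    have := Finset.single_le_sum (fun i _ => hu0 i) hjN
    linarith

/-- A non-negative super-polynomially small sequence is summable (comparison with `M∕(j+1)²`). [folklore] -/
theorem summable_of_superpoly {s : ℕ → ℝ} (hs0 : ∀ j, 0 ≤ s j) (hs : ∀ a : ℕ, Tendsto (fun j : ℕ => ((j : ℝ) + 1) ^ a * s j) atTop (𝓝 0)) :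
    Summable s := by
  obtain ⟨M, hM0, hM⟩ := exists_bound_of_tendsto_zero (fun j => by have := hs0 j; positivity) (hs 2)
  have hsum : Summable (fun j : ℕ => M * (1 / ((j : ℝ) + 1) ^ 2)) := by
    have h := (summable_nat_add_iff 1).mpr (Real.summable_one_div_nat_pow.mpr one_lt_two)
    refine (h.congr fun j => ?_).mul_left M
    push_cast; ring
  refine Summable.of_nonneg_of_le hs0 (fun j => ?_) hsum
  have hj : 0 < ((j : ℝ) + 1) ^ 2 := by positivity
  rw [mul_one_div, le_div_iff₀ hj, mul_comm]
  exact hM j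

/-- Finite partial sums over the free levels `J < j ≤ K` are bounded by the `tsum` tail from `J + 1`. [folklore] -/
theorem sum_Ico_le_tsum_tail {s : ℕ → ℝ} (hs0 : ∀ j, 0 ≤ s j) (hs : Summable s) (J K : ℕ) :
    ∑ j ∈ Finset.Ico (J + 1) (K + 1), s j ≤ ∑' k, s (k + (J + 1)) := by
  rw [Finset.sum_Ico_eq_sum_range]
  have hsh : Summable (fun k => s (k + (J + 1))) := (summable_nat_add_iff (J + 1)).mpr hs
  calc ∑ k ∈ Finset.range (K + 1 - (J + 1)), s (J + 1 + k) = ∑ k ∈ Finset.range (K + 1 - (J + 1)), s (k + (J + 1)) :=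
        Finset.sum_congr rfl fun k _ => by rw [add_comm]
    _ ≤ ∑' k, s (k + (J + 1)) := hsh.sum_le_tsum _ fun k _ => hs0 _

/-- The `tsum` tails of a non-negative super-polynomially small sequence are super-polynomially small. [folklore] -/
theorem superpoly_tsum_tail {s : ℕ → ℝ} (hs0 : ∀ j, 0 ≤ s j) (hs : ∀ a : ℕ, Tendsto (fun j : ℕ => ((j : ℝ) + 1) ^ a * s j) atTop (𝓝 0)) (a : ℕ) :
    Tendsto (fun J : ℕ => ((J : ℝ) + 1) ^ a * ∑' k, s (k + (J + 1))) atTop (𝓝 0) := by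
  -- `t j := (j+1)^a s j` is again non-negative and super-polynomially small, hence summable; its tails tend to zero
  set t : ℕ → ℝ := fun j => ((j : ℝ) + 1) ^ a * s j with ht
  have ht0 : ∀ j, 0 ≤ t j := fun j => by have := hs0 j; positivity
  have hts : ∀ b : ℕ, Tendsto (fun j : ℕ => ((j : ℝ) + 1) ^ b * t j) atTop (𝓝 0) := fun b => by
    refine (hs (b + a)).congr' (Eventually.of_forall fun j => ?_)
    simp only [ht, pow_add]; ring
  have htsum : Summable t := summable_of_superpoly ht0 hts
  have hss : Summable s := summable_of_superpoly hs0 hs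
  have htail : Tendsto (fun J : ℕ => ∑' k, t (k + (J + 1))) atTop (𝓝 0) :=
    (tendsto_sum_nat_add t).comp (tendsto_add_atTop_nat 1)
  refine squeeze_zero (fun J => mul_nonneg (by positivity) (tsum_nonneg fun k => hs0 _)) (fun J => ?_) htail
  have h1 : Summable (fun k => s (k + (J + 1))) := (summable_nat_add_iff (J + 1)).mpr hss
  have h2 : Summable (fun k => t (k + (J + 1))) := (summable_nat_add_iff (J + 1)).mpr htsum
  rw [← tsum_mul_left]
  refine Summable.tsum_le_tsum (fun k => ?_) (h1.mul_left _) h2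
  simp only [ht]
  refine mul_le_mul_of_nonneg_right ?_ (hs0 _)
  refine pow_le_pow_left₀ (by positivity) ?_ a
  push_cast; linarith [Nat.cast_nonneg (α := ℝ) k]

/-- The elementary odds step: `a ≤ g + σ·a`, `0 ≤ σ ≤ ½`, `a, g ≥ 0` ⟹ `a ≤ e^{2σ}·g` (from `1 + 2σ ≤ e^{2σ}`). [folklore] -/
theorem le_exp_mul_of_le_add {a g σ : ℝ} (ha : 0 ≤ a) (hg : 0 ≤ g) (hσ0 : 0 ≤ σ) (hσ : σ ≤ 1 / 2) (h : a ≤ g + σ * a) :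
    a ≤ Real.exp (2 * σ) * g := by
  have hE : 1 + 2 * σ ≤ Real.exp (2 * σ) := by have := Real.add_one_le_exp (2 * σ); linarith
  have h1 : 0 ≤ (Real.exp (2 * σ) - (1 + 2 * σ)) * g := mul_nonneg (by linarith) hg
  have h2 : 0 ≤ (1 + 2 * σ) * (g - (1 - σ) * a) := mul_nonneg (by linarith) (by nlinarith)
  have h3 : 0 ≤ σ * (1 - 2 * σ) * a := mul_nonneg (mul_nonneg hσ0 (by linarith)) ha
  nlinarith

end Analysis

section Doors

/-- ★ **MSTEP∘ ⟸ MSTEP₁∘ + DEEPSTEP∘** (PROVED): a free level is either the first one (`j = J + 1`) or deep (`j ≥ J + 2`); take `s := s₁ + s₂`.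
[cite: Balaban1985UV3, (38)-(40) p.266] -/
theorem multiStepTail_of_oneStep_deepStep : OneStepTailIntCan → DeepStepTailIntCan → MultiStepTailIntCan := by
  intro h1 h2 L
  obtain ⟨c₁, hc₁, hc₁1, H1⟩ := h1 L
  obtain ⟨c₂, hc₂, -, H2⟩ := h2 L
  refine ⟨min c₁ c₂, lt_min hc₁ hc₂, (min_le_left _ _).trans hc₁1, fun c hc hcle => ?_⟩
  obtain ⟨pS₁, H1⟩ := H1 c hc (hcle.trans (min_le_left _ _))
  obtain ⟨pS₂, H2⟩ := H2 c hc (hcle.trans (min_le_right _ _))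
  refine ⟨max pS₁ pS₂, fun b₀ p₀ hb hpS hp => ?_⟩
  obtain ⟨γ₁, hγ₁, H1⟩ := H1 b₀ p₀ hb ((le_max_left _ _).trans hpS) hp
  obtain ⟨γ₂, hγ₂, H2⟩ := H2 b₀ p₀ hb ((le_max_right _ _).trans hpS) hp
  refine ⟨min γ₁ γ₂, lt_min hγ₁ hγ₂, fun F γ hFL hγ hγle => ?_⟩
  obtain ⟨s₁, hs₁0, hs₁t, H1⟩ := H1 F γ hFL hγ (hγle.trans (min_le_left _ _))
  obtain ⟨s₂, hs₂0, hs₂t, H2⟩ := H2 F γ hFL hγ (hγle.trans (min_le_right _ _))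
  refine ⟨fun j => s₁ j + s₂ j, fun j => add_nonneg (hs₁0 j) (hs₂0 j), fun a => ?_, ?_⟩
  · have := (hs₁t a).add (hs₂t a)
    rw [add_zero] at this
    exact this.congr' (Eventually.of_forall fun j => by ring)
  · intro J j K hJK hjK hJj B hB hBW
    rcases Nat.lt_or_ge j (J + 2) with hj | hj
    · obtain rfl : j = J + 1 := by omega
      calc gibbsK F ℰp γ K (descendTo F ℰp J K hJK ⁻¹' B ∩ {V | ¬ PlaqSmall (θBal F.L γ b₀ p₀ (J + 1)) (descendTo F ℰp (J + 1) K hjK V)})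
            ≤ ENNReal.ofReal (s₁ (J + 1)) * gibbsK F ℰp γ K (descendTo F ℰp J K hJK ⁻¹' B) := H1 J K hjK B hB hBW
        _ ≤ ENNReal.ofReal (s₁ (J + 1) + s₂ (J + 1)) * gibbsK F ℰp γ K (descendTo F ℰp J K hJK ⁻¹' B) :=
            mul_le_mul_right' (ENNReal.ofReal_le_ofReal (le_add_of_nonneg_right (hs₂0 _))) _
    · calc gibbsK F ℰp γ K (descendTo F ℰp J K hJK ⁻¹' B ∩ {V | ¬ PlaqSmall (θBal F.L γ b₀ p₀ j) (descendTo F ℰp j K hjK V)})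
            ≤ ENNReal.ofReal (s₂ j) * gibbsK F ℰp γ K (descendTo F ℰp J K hJK ⁻¹' B) := H2 J j K hJK hjK hj B hB hBW
        _ ≤ ENNReal.ofReal (s₁ j + s₂ j) * gibbsK F ℰp γ K (descendTo F ℰp J K hJK ⁻¹' B) :=
            mul_le_mul_right' (ENNReal.ofReal_le_ofReal (le_add_of_nonneg_left (hs₁0 _))) _


/-- ★ **THE UNION BOUND OVER THE FREE LEVELS** at one `(J, K)`: if every free level `J < j ≤ K` leaves its `b₀`-window with conditional probability `≤ s_j` given the
interior level-`J` event `B`, then the bad-history part of `D_{J,K}⁻¹B` has mass `≤ (Σ_{J<j≤K} s_j)·Gibbs_K(D_{J,K}⁻¹B)` (✓`mem_histGood_iff_descendTo`; the level `j = J`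
itself is good because the interior window lies inside the full one, `0 < γ ≤ 1`, `c ≤ 1`). [cite: Balaban1985UV3, (7) p.257 and (38)-(40) p.266] -/
theorem badHistory_le_sum (F : T3Family) {γ b₀ p₀ c : ℝ} (hγ : 0 < γ) (hγ1 : γ ≤ 1) (hb : 0 < b₀) (hc1 : c ≤ 1) {J K : ℕ} (hJK : J ≤ K)
    {s : ℕ → ℝ} (hs0 : ∀ j, 0 ≤ s j) {B : Set (GaugeField (F.P J) 0 (Matrix.specialUnitaryGroup (Fin 2) ℂ))}
    (hBW : B ⊆ {U | PlaqSmall (θBal F.L γ (c * b₀) p₀ J) U})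
    (hstep : ∀ (j : ℕ) (hjK : j ≤ K), J < j →
      gibbsK F ℰp γ K (descendTo F ℰp J K hJK ⁻¹' B ∩ {V | ¬ PlaqSmall (θBal F.L γ b₀ p₀ j) (descendTo F ℰp j K hjK V)}) ≤
        ENNReal.ofReal (s j) * gibbsK F ℰp γ K (descendTo F ℰp J K hJK ⁻¹' B)) :
    gibbsK F ℰp γ K (descendTo F ℰp J K hJK ⁻¹' B ∩ (histGood F ℰp (θBal F.L γ b₀ p₀) K J)ᶜ) ≤
      ENNReal.ofReal (∑ j ∈ Finset.Ico (J + 1) (K + 1), s j) * gibbsK F ℰp γ K (descendTo F ℰp J K hJK ⁻¹' B) := by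
  set A := descendTo F ℰp J K hJK ⁻¹' B with hA
  set bad : ℕ → Set (GaugeField (F.P K) 0 (Matrix.specialUnitaryGroup (Fin 2) ℂ)) :=
    fun j => {V | ∃ hjK : j ≤ K, ¬ PlaqSmall (θBal F.L γ b₀ p₀ j) (descendTo F ℰp j K hjK V)} with hbad
  have hL1 : 1 ≤ F.L := F.hL.2.le
  -- the bad-history part is covered by the level events
  have hcover : A ∩ (histGood F ℰp (θBal F.L γ b₀ p₀) K J)ᶜ ⊆ ⋃ j ∈ Finset.Ico (J + 1) (K + 1), A ∩ bad j := by
    rintro V ⟨hVA, hVG⟩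
    rw [Set.mem_compl_iff, mem_histGood_iff_descendTo] at hVG
    push_neg at hVG
    obtain ⟨j, hJj, hjK, hj⟩ := hVG
    have hne : j ≠ J := by
      rintro rfl
      exact hj (T3PrintedMinimiserExistence.plaqSmall_of_le (θBal_mul_le hL1 hγ hγ1 hb hc1 p₀ j) (hBW hVA))
    refine Set.mem_iUnion₂.2 ⟨j, Finset.mem_Ico.2 ⟨by omega, by omega⟩, hVA, hjK, hj⟩
  calc gibbsK F ℰp γ K (A ∩ (histGood F ℰp (θBal F.L γ b₀ p₀) K J)ᶜ)
        ≤ gibbsK F ℰp γ K (⋃ j ∈ Finset.Ico (J + 1) (K + 1), A ∩ bad j) := measure_mono hcover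
    _ ≤ ∑ j ∈ Finset.Ico (J + 1) (K + 1), gibbsK F ℰp γ K (A ∩ bad j) := measure_biUnion_finset_le _ _
    _ ≤ ∑ j ∈ Finset.Ico (J + 1) (K + 1), ENNReal.ofReal (s j) * gibbsK F ℰp γ K A := by
        refine Finset.sum_le_sum fun j hj => ?_
        obtain ⟨hJj, hjK⟩ := Finset.mem_Ico.1 hj
        have hjK' : j ≤ K := by omega
        have hset : A ∩ bad j = A ∩ {V | ¬ PlaqSmall (θBal F.L γ b₀ p₀ j) (descendTo F ℰp j K hjK' V)} := by
          ext V
          simp only [hbad, Set.mem_inter_iff, Set.mem_setOf_eq]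
          exact ⟨fun ⟨h1, _, h2⟩ => ⟨h1, h2⟩, fun ⟨h1, h2⟩ => ⟨h1, hjK', h2⟩⟩
        rw [hset]
        exact hstep j hjK' (by omega)
    _ = ENNReal.ofReal (∑ j ∈ Finset.Ico (J + 1) (K + 1), s j) * gibbsK F ℰp γ K A := by
        rw [ENNReal.ofReal_sum_of_nonneg fun j _ => hs0 j, Finset.sum_mul]

end Doors

/-! ## §4 PROVED: THE STOPPED PERSISTENCE CHAIN (FILE J's re-basing, inequality reversed) and the existence of the stopping level -/

section Chain

/-- The re-based running event (level `J` in `B`, levels `J < j ≤ J + k` in their windows, read on the level-`(J+k)` tower) is measurable. [cite: Balaban1985Averaging, (10) p.19] -/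
theorem measurableSet_rebased (F : T3Family) (θ : ℕ → ℝ) (J k : ℕ) {B : Set (GaugeField (F.P J) 0 (Matrix.specialUnitaryGroup (Fin 2) ℂ))}
    (hB : MeasurableSet B) :
    MeasurableSet {V : GaugeField (F.P (J + k)) 0 (Matrix.specialUnitaryGroup (Fin 2) ℂ) |
      descendTo F ℰp J (J + k) (Nat.le_add_right J k) V ∈ B ∧
        ∀ j, J < j → ∀ hj : j ≤ J + k, PlaqSmall (θ j) (descendTo F ℰp j (J + k) hj V)} := by
  have h1 : MeasurableSet {V : GaugeField (F.P (J + k)) 0 (Matrix.specialUnitaryGroup (Fin 2) ℂ) |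
      descendTo F ℰp J (J + k) (Nat.le_add_right J k) V ∈ B} :=
    measurable_descendTo F ℰp measurableE_ℰp _ hB
  have h2 : MeasurableSet {V : GaugeField (F.P (J + k)) 0 (Matrix.specialUnitaryGroup (Fin 2) ℂ) |
      ∀ j, J < j → ∀ hj : j ≤ J + k, PlaqSmall (θ j) (descendTo F ℰp j (J + k) hj V)} := by
    have hset : {V : GaugeField (F.P (J + k)) 0 (Matrix.specialUnitaryGroup (Fin 2) ℂ) |
        ∀ j, J < j → ∀ hj : j ≤ J + k, PlaqSmall (θ j) (descendTo F ℰp j (J + k) hj V)} =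
        ⋂ j ∈ Finset.Ioc J (J + k), {V | ∀ hj : j ≤ J + k, PlaqSmall (θ j) (descendTo F ℰp j (J + k) hj V)} := by
      ext V
      simp only [Set.mem_setOf_eq, Set.mem_iInter, Finset.mem_Ioc, and_imp]
      exact ⟨fun h i hJi _ hj => h i hJi hj, fun h j hJj hj => h j hJj hj hj⟩
    rw [hset]
    refine MeasurableSet.biInter (Finset.countable_toSet _) fun j hj => ?_
    have hj' : j ≤ J + k := (Finset.mem_Ioc.mp hj).2
    have : {V : GaugeField (F.P (J + k)) 0 (Matrix.specialUnitaryGroup (Fin 2) ℂ) |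
        ∀ hj : j ≤ J + k, PlaqSmall (θ j) (descendTo F ℰp j (J + k) hj V)} =
        descendTo F ℰp j (J + k) hj' ⁻¹' {V | PlaqSmall (θ j) V} := by
      ext V
      simp only [Set.mem_setOf_eq, Set.mem_preimage]
      exact ⟨fun h => h hj', fun h _ => h⟩
    rw [this]
    exact measurable_descendTo F ℰp measurableE_ℰp _ (measurableSet_plaqSmall _)
  simpa only [Set.setOf_and] using h1.inter h2

/-- The re-based running event lies inside the level-`(J+k)` window (for `k = 0` through `B ⊆ W_J`, else through its own last constraint). [cite: Balaban1985UV3, (7) p.257] -/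
theorem rebased_subset_window (F : T3Family) (θ : ℕ → ℝ) (J k : ℕ) {B : Set (GaugeField (F.P J) 0 (Matrix.specialUnitaryGroup (Fin 2) ℂ))}
    (hBW : B ⊆ {V | PlaqSmall (θ J) V}) :
    {V : GaugeField (F.P (J + k)) 0 (Matrix.specialUnitaryGroup (Fin 2) ℂ) |
      descendTo F ℰp J (J + k) (Nat.le_add_right J k) V ∈ B ∧
        ∀ j, J < j → ∀ hj : j ≤ J + k, PlaqSmall (θ j) (descendTo F ℰp j (J + k) hj V)} ⊆ {V | PlaqSmall (θ (J + k)) V} := by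
  intro V hV
  cases k with
  | zero =>
    have e : descendTo F ℰp J (J + 0) (Nat.le_add_right J 0) V = V := descendTo_self F ℰp J V
    have h0 := hV.1
    rw [e] at h0
    exact hBW h0
  | succ k' =>
    have h2 := hV.2 (J + (k' + 1)) (by omega) le_rfl
    rwa [descendTo_self] at h2

/-- ★ **THE PERSISTENCE CHAIN TO DEPTH `k`**: if at every level `i` with `i + 1 ≤ K` the run persists from the interior window `W_i` into the interior window `W_{i+1}`
with conditional probability `≥ q_i ∈ (0, 1]` given any measurable interior level-`i` event, then for every measurable `B ⊆ W_J` and every depth `k` with `J + k ≤ K`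
the running event «level `J` in `B`, levels `J < j ≤ J + k` in their interior windows» has mass `≥ (Π_{i ∈ [J, J+k)} q_i)·Gibbs_K(D_{J,K}⁻¹B)` (induction on `k`; the
running event at depth `k` is re-based on the level-`(J+k)` tower by ✓`runningEvent_eq_preimage`, where the one-level hypothesis applies). [cite: Balaban1985UV3, (7)
p.257 and (38)-(40) p.266; Balaban1987RG1, (0.11) p.253] -/
theorem persist_chain (F : T3Family) (γ : ℝ) (θ : ℕ → ℝ) (K J : ℕ) (hJK : J ≤ K) (q : ℕ → ℝ) (hq0 : ∀ i, 0 ≤ q i)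
    (hpers : ∀ (i : ℕ) (hiK : i + 1 ≤ K) (B' : Set (GaugeField (F.P i) 0 (Matrix.specialUnitaryGroup (Fin 2) ℂ))),
      MeasurableSet B' → B' ⊆ {V | PlaqSmall (θ i) V} →
        ENNReal.ofReal (q i) * gibbsK F ℰp γ K (descendTo F ℰp i K ((Nat.le_succ i).trans hiK) ⁻¹' B') ≤
          gibbsK F ℰp γ K (descendTo F ℰp i K ((Nat.le_succ i).trans hiK) ⁻¹' B' ∩
            descendTo F ℰp (i + 1) K hiK ⁻¹' {V | PlaqSmall (θ (i + 1)) V}))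
    {B : Set (GaugeField (F.P J) 0 (Matrix.specialUnitaryGroup (Fin 2) ℂ))} (hB : MeasurableSet B) (hBW : B ⊆ {V | PlaqSmall (θ J) V}) :
    ∀ (k : ℕ) (hk : J + k ≤ K),
      ENNReal.ofReal (∏ i ∈ Finset.Ico J (J + k), q i) * gibbsK F ℰp γ K (descendTo F ℰp J K hJK ⁻¹' B) ≤
        gibbsK F ℰp γ K {U | descendTo F ℰp J K hJK U ∈ B ∧
          ∀ j, J < j → j ≤ J + k → ∀ hjK : j ≤ K, PlaqSmall (θ j) (descendTo F ℰp j K hjK U)} := by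
  intro k
  induction k with
  | zero =>
    intro hk
    rw [runningEvent_zero F θ K hJK B]
    simp
  | succ k ih =>
    intro hk
    have hk' : J + k ≤ K := by omega
    have hk1 : J + k + 1 ≤ K := by omega
    -- re-base the running event at depth `k` on the level-`(J+k)` tower
    set B' : Set (GaugeField (F.P (J + k)) 0 (Matrix.specialUnitaryGroup (Fin 2) ℂ)) :=
      {V | descendTo F ℰp J (J + k) (Nat.le_add_right J k) V ∈ B ∧
        ∀ j, J < j → ∀ hj : j ≤ J + k, PlaqSmall (θ j) (descendTo F ℰp j (J + k) hj V)} with hB'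
    have hB'm : MeasurableSet B' := measurableSet_rebased F θ J k hB
    have hB'W : B' ⊆ {V | PlaqSmall (θ (J + k)) V} := rebased_subset_window F θ J k hBW
    -- ONE-LEVEL PERSISTENCE at `i = J + k`
    have hstep := hpers (J + k) hk1 B' hB'm hB'W
    -- the two events of `hstep` are the running events at depths `k` and `k+1`
    have hEk := runningEvent_eq_preimage F θ K hk' hJK B
    have hEk1 : descendTo F ℰp (J + k) K hk' ⁻¹' B' ∩
          descendTo F ℰp (J + k + 1) K hk1 ⁻¹' {V | PlaqSmall (θ (J + k + 1)) V} =
        {U | descendTo F ℰp J K hJK U ∈ B ∧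
          ∀ j, J < j → j ≤ J + (k + 1) → ∀ hjK : j ≤ K, PlaqSmall (θ j) (descendTo F ℰp j K hjK U)} := by
      rw [← hEk]
      ext U
      simp only [Set.mem_inter_iff, Set.mem_setOf_eq, Set.mem_preimage]
      constructor
      · rintro ⟨⟨hB0, h⟩, hnew⟩
        refine ⟨hB0, fun j hJj hj hjK => ?_⟩
        rcases Nat.eq_or_lt_of_le hj with hEq | hlt'
        · subst hEq
          exact hnew
        · exact h j hJj (by omega) hjK
      · rintro ⟨hB0, h⟩
        exact ⟨⟨hB0, fun j hJj hj hjK => h j hJj (by omega) hjK⟩, h (J + k + 1) (by omega) (by omega) _⟩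
    have hprod : ∏ i ∈ Finset.Ico J (J + (k + 1)), q i = (∏ i ∈ Finset.Ico J (J + k), q i) * q (J + k) := by
      rw [show J + (k + 1) = J + k + 1 by omega, Finset.prod_Ico_succ_top (by omega : J ≤ J + k)]
    calc ENNReal.ofReal (∏ i ∈ Finset.Ico J (J + (k + 1)), q i) * gibbsK F ℰp γ K (descendTo F ℰp J K hJK ⁻¹' B)
        = ENNReal.ofReal (q (J + k)) *
            (ENNReal.ofReal (∏ i ∈ Finset.Ico J (J + k), q i) * gibbsK F ℰp γ K (descendTo F ℰp J K hJK ⁻¹' B)) := by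
          rw [hprod, ENNReal.ofReal_mul (Finset.prod_nonneg fun i _ => hq0 i), ← mul_assoc, mul_comm (ENNReal.ofReal (q (J + k)))]
      _ ≤ ENNReal.ofReal (q (J + k)) *
            gibbsK F ℰp γ K {U | descendTo F ℰp J K hJK U ∈ B ∧
              ∀ j, J < j → j ≤ J + k → ∀ hjK : j ≤ K, PlaqSmall (θ j) (descendTo F ℰp j K hjK U)} := mul_le_mul' le_rfl (ih hk')
      _ = ENNReal.ofReal (q (J + k)) * gibbsK F ℰp γ K (descendTo F ℰp (J + k) K hk' ⁻¹' B') := by rw [hEk]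
      _ ≤ gibbsK F ℰp γ K (descendTo F ℰp (J + k) K hk' ⁻¹' B' ∩
            descendTo F ℰp (J + k + 1) K hk1 ⁻¹' {V | PlaqSmall (θ (J + k + 1)) V}) := hstep
      _ = gibbsK F ℰp γ K {U | descendTo F ℰp J K hJK U ∈ B ∧
            ∀ j, J < j → j ≤ J + (k + 1) → ∀ hjK : j ≤ K, PlaqSmall (θ j) (descendTo F ℰp j K hjK U)} := by rw [hEk1]

/-- **THE STOPPING LEVEL EXISTS**: the `tsum` tails of a summable non-negative sequence are eventually `≤ ½`, at a depth `k₀` of our choosing beyond any floor. [folklore] -/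
theorem exists_depth_tail_le_half {s : ℕ → ℝ} (hs0 : ∀ j, 0 ≤ s j)
    (hs : ∀ a : ℕ, Tendsto (fun j : ℕ => ((j : ℝ) + 1) ^ a * s j) atTop (𝓝 0)) (J : ℕ) :
    ∃ k₀ : ℕ, ∑' i, s (i + (J + k₀ + 1)) ≤ 1 / 2 := by
  have h0 : Tendsto (fun n : ℕ => ∑' i, s (i + (n + 1))) atTop (𝓝 0) := by
    simpa only [pow_zero, one_mul] using superpoly_tsum_tail hs0 hs 0
  obtain ⟨N, hN⟩ := eventually_atTop.1 (h0.eventually (ge_mem_nhds (by norm_num : (0 : ℝ) < 1 / 2)))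
  exact ⟨N, hN (J + N) (by omega)⟩

end Chain

/-! ## §5 PROVED: POS∘ ⟸ PERS₁∘ + MSTEP∘ (chain to the stopping level, then the union bound above it) -/

section Assembly

/-- ★★★ **POS∘ ⟸ PERS₁∘ + MSTEP∘** (PROVED).  Common fraction `c ≤ min c₀ᵢ ≤ 1`, `γ₁ := min (min γ₁ᴾ γ₁ᴹ) 1`.  Given `F, γ, J`: `s` from MSTEP∘, `q_i` from PERS₁∘
(`choose`), `q̃_i := min (q_i) 1`, the stopping depth `k₀` with `Σ_{j > J+k₀} s_j ≤ ½`, and `q_J^{POS} := ½·Π_{i ∈ [J, J+k₀)} q̃_i`.  For a run `K`: if `K ≤ J + k₀` the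
persistence chain to depth `K − J` already lies inside `D_{J,K}⁻¹B ∩ histGood(b₀) K J` (interior windows inside full ones, ✓`θBal_mul_le`) and the unused factors are
`≤ 1`; if `K > J + k₀`, chain to depth `k₀`, re-base the running event as `D_{J+k₀,K}⁻¹B″` with `B″` measurable inside the interior window at level `J + k₀`
(✓`runningEvent_eq_preimage`), apply MSTEP∘ AT LEVEL `J + k₀` through ✓`badHistory_le_sum`: the bad-history part has mass `≤ ½·Gibbs_K(D⁻¹B″)`, so the good part
has mass `≥ ½·Gibbs_K(D⁻¹B″) ≥ ½·Π q̃·Gibbs_K(D_{J,K}⁻¹B)`, and it lies inside `D_{J,K}⁻¹B ∩ histGood(b₀) K J` (levels `≤ J + k₀` interior, levels above good;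
✓`descendTo_descendTo`, ✓`mem_histGood_iff_descendTo`). [cite: Balaban1985UV3, (7) p.257 and (38)-(40) p.266; Balaban1989LargeFieldII, (1.77)-(1.79) p.383] -/
theorem goodHistoryPositiveInt_of_persistence_multiStep :
    OneLevelPersistenceIntCan → MultiStepTailIntCan → GoodHistoryPositiveIntCan := by
  intro hP hM L
  obtain ⟨c₁, hc₁, hc₁1, H1⟩ := hM L
  obtain ⟨c₂, hc₂, -, H2⟩ := hP L
  refine ⟨min c₁ c₂, lt_min hc₁ hc₂, (min_le_left _ _).trans hc₁1, fun c hc hcle => ?_⟩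
  have hc1 : c ≤ 1 := (hcle.trans (min_le_left _ _)).trans hc₁1
  obtain ⟨pS₁, H1⟩ := H1 c hc (hcle.trans (min_le_left _ _))
  obtain ⟨pS₂, H2⟩ := H2 c hc (hcle.trans (min_le_right _ _))
  refine ⟨max pS₁ pS₂, fun b₀ p₀ hb hpS hp => ?_⟩
  obtain ⟨γ₁, hγ₁, H1⟩ := H1 b₀ p₀ hb ((le_max_left _ _).trans hpS) hp
  obtain ⟨γ₂, hγ₂, H2⟩ := H2 b₀ p₀ hb ((le_max_right _ _).trans hpS) hp
  refine ⟨min (min γ₁ γ₂) 1, lt_min (lt_min hγ₁ hγ₂) one_pos, fun F γ hFL hγ hγle J => ?_⟩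
  have hγ1 : γ ≤ 1 := hγle.trans (min_le_right _ _)
  have hL1 : 1 ≤ F.L := F.hL.2.le
  obtain ⟨s, hs0, hst, HM⟩ := H1 F γ hFL hγ (hγle.trans ((min_le_left _ _).trans (min_le_left _ _)))
  have HP := H2 F γ hFL hγ (hγle.trans ((min_le_left _ _).trans (min_le_right _ _)))
  choose q hq0 hq using HP
  -- the interior and the full window profiles
  set θc : ℕ → ℝ := θBal F.L γ (c * b₀) p₀ with hθc
  set θf : ℕ → ℝ := θBal F.L γ b₀ p₀ with hθf
  have hcf : ∀ (j : ℕ) (V : GaugeField (F.P j) 0 (Matrix.specialUnitaryGroup (Fin 2) ℂ)), PlaqSmall (θc j) V → PlaqSmall (θf j) V :=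
    fun j V hV => T3PrintedMinimiserExistence.plaqSmall_of_le (θBal_mul_le hL1 hγ hγ1 hb hc1 p₀ j) hV
  -- truncated floors `q̃ ≤ 1` and the stopping depth
  set qt : ℕ → ℝ := fun i => min (q i) 1 with hqt
  have hqt0 : ∀ i, 0 < qt i := fun i => lt_min (hq0 i) one_pos
  have hqt1 : ∀ i, qt i ≤ 1 := fun i => min_le_right _ _
  obtain ⟨k₀, hk₀⟩ := exists_depth_tail_le_half hs0 hst J
  have hss : Summable s := summable_of_superpoly hs0 hst
  set Q : ℝ := ∏ i ∈ Finset.Ico J (J + k₀), qt i with hQ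
  have hQ0 : 0 < Q := Finset.prod_pos fun i _ => hqt0 i
  refine ⟨Q / 2, by positivity, fun K hJK B hB hBW => ?_⟩
  haveI := isProbabilityMeasure_gibbsK F ℰp hγ.le K
  -- PERS₁∘ with the truncated floors, in the shape `persist_chain` consumes
  have hpers : ∀ (i : ℕ) (hiK : i + 1 ≤ K) (B' : Set (GaugeField (F.P i) 0 (Matrix.specialUnitaryGroup (Fin 2) ℂ))),
      MeasurableSet B' → B' ⊆ {V | PlaqSmall (θc i) V} →
        ENNReal.ofReal (qt i) * gibbsK F ℰp γ K (descendTo F ℰp i K ((Nat.le_succ i).trans hiK) ⁻¹' B') ≤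
          gibbsK F ℰp γ K (descendTo F ℰp i K ((Nat.le_succ i).trans hiK) ⁻¹' B' ∩
            descendTo F ℰp (i + 1) K hiK ⁻¹' {V | PlaqSmall (θc (i + 1)) V}) := fun i hiK B' hB' hB'W =>
    (mul_le_mul_right' (ENNReal.ofReal_le_ofReal (min_le_left _ _)) _).trans (hq i K hiK B' hB' hB'W)
  have hchain := persist_chain F γ θc K J hJK qt (fun i => (hqt0 i).le) hpers hB hBW
  -- the running event at depth `k` lies inside `D_{J,K}⁻¹B ∩ histGood(b₀) K J` as soon as it covers all levels `≤ K`
  have hrun_good : ∀ (k : ℕ), K ≤ J + k →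
      {U : GaugeField (F.P K) 0 (Matrix.specialUnitaryGroup (Fin 2) ℂ) | descendTo F ℰp J K hJK U ∈ B ∧
        ∀ j, J < j → j ≤ J + k → ∀ hjK : j ≤ K, PlaqSmall (θc j) (descendTo F ℰp j K hjK U)} ⊆
      descendTo F ℰp J K hJK ⁻¹' B ∩ histGood F ℰp θf K J := by
    intro k hKk U hU
    refine ⟨hU.1, ?_⟩
    rw [mem_histGood_iff_descendTo]
    intro j hJj hjK
    rcases Nat.eq_or_lt_of_le hJj with hEq | hlt
    · subst hEq
      exact hcf _ _ (hBW hU.1)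
    · exact hcf _ _ (hU.2 j hlt (by omega) hjK)
  by_cases hK : K ≤ J + k₀
  · -- the chain alone, to depth `K − J`
    have hk : J + (K - J) ≤ K := by omega
    have h1 := hchain (K - J) hk
    have hQle : Q / 2 ≤ ∏ i ∈ Finset.Ico J (J + (K - J)), qt i := by
      have hsplit : Q = (∏ i ∈ Finset.Ico J (J + (K - J)), qt i) * ∏ i ∈ Finset.Ico (J + (K - J)) (J + k₀), qt i := by
        rw [hQ, Finset.prod_Ico_consecutive _ (by omega : J ≤ J + (K - J)) (by omega : J + (K - J) ≤ J + k₀)]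
      have hle1 : ∏ i ∈ Finset.Ico (J + (K - J)) (J + k₀), qt i ≤ 1 := Finset.prod_le_one (fun i _ => (hqt0 i).le) fun i _ => hqt1 i
      have hP0 : 0 ≤ ∏ i ∈ Finset.Ico J (J + (K - J)), qt i := Finset.prod_nonneg fun i _ => (hqt0 i).le
      have : Q ≤ ∏ i ∈ Finset.Ico J (J + (K - J)), qt i := by
        rw [hsplit]; exact mul_le_of_le_one_right hP0 hle1
      linarith
    calc ENNReal.ofReal (Q / 2) * gibbsK F ℰp γ K (descendTo F ℰp J K hJK ⁻¹' B)
        ≤ ENNReal.ofReal (∏ i ∈ Finset.Ico J (J + (K - J)), qt i) * gibbsK F ℰp γ K (descendTo F ℰp J K hJK ⁻¹' B) :=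
          mul_le_mul_right' (ENNReal.ofReal_le_ofReal hQle) _
      _ ≤ _ := h1
      _ ≤ gibbsK F ℰp γ K (descendTo F ℰp J K hJK ⁻¹' B ∩ histGood F ℰp θf K J) := measure_mono (hrun_good (K - J) (by omega))
  · -- chain to depth `k₀`, re-base at level `J + k₀`, then MSTEP∘ above it
    have hk : J + k₀ ≤ K := by omega
    have h1 := hchain k₀ hk
    set B'' : Set (GaugeField (F.P (J + k₀)) 0 (Matrix.specialUnitaryGroup (Fin 2) ℂ)) :=
      {V | descendTo F ℰp J (J + k₀) (Nat.le_add_right J k₀) V ∈ B ∧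
        ∀ j, J < j → ∀ hj : j ≤ J + k₀, PlaqSmall (θc j) (descendTo F ℰp j (J + k₀) hj V)} with hB''
    have hEk := runningEvent_eq_preimage F θc K hk hJK B
    -- measurability and interiority of `B″`
    have hB''m : MeasurableSet B'' := measurableSet_rebased F θc J k₀ hB
    have hB''W : B'' ⊆ {V | PlaqSmall (θc (J + k₀)) V} := rebased_subset_window F θc J k₀ hBW
    -- MSTEP∘ at level `J + k₀`, summed over the levels above (union bound), total `≤ ½`
    set μ := gibbsK F ℰp γ K with hμ
    set A := descendTo F ℰp (J + k₀) K hk ⁻¹' B'' with hA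
    set G := histGood F ℰp θf K (J + k₀) with hG
    have hGm : MeasurableSet G := measurableSet_histGood F ℰp measurableE_ℰp _ K (J + k₀)
    have hbad : μ (A ∩ Gᶜ) ≤ ENNReal.ofReal (1 / 2) * μ A := by
      refine (badHistory_le_sum F hγ hγ1 hb hc1 hk hs0 hB''W fun j hjK hJj => HM (J + k₀) j K hk hjK hJj B'' hB''m hB''W).trans ?_
      exact mul_le_mul_right' (ENNReal.ofReal_le_ofReal ((sum_Ico_le_tsum_tail hs0 hss (J + k₀) K).trans hk₀)) _
    have hfinA : μ A ≠ ∞ := measure_ne_top μ A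
    have hfinAG : μ (A ∩ G) ≠ ∞ := measure_ne_top μ _
    have hsplit : μ A ≤ μ (A ∩ G) + ENNReal.ofReal (1 / 2) * μ A := by
      calc μ A = μ (A ∩ G) + μ (A \ G) := (measure_inter_add_diff A hGm).symm
        _ ≤ μ (A ∩ G) + ENNReal.ofReal (1 / 2) * μ A := by rw [Set.diff_eq]; exact add_le_add le_rfl hbad
    have hhalf : ENNReal.ofReal (1 / 2) * μ A ≤ μ (A ∩ G) := by
      have hreal : (μ A).toReal ≤ (μ (A ∩ G)).toReal + 1 / 2 * (μ A).toReal := by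
        have h := ENNReal.toReal_mono (ENNReal.add_ne_top.2 ⟨hfinAG, ENNReal.mul_ne_top ENNReal.ofReal_ne_top hfinA⟩) hsplit
        rwa [ENNReal.toReal_add hfinAG (ENNReal.mul_ne_top ENNReal.ofReal_ne_top hfinA), ENNReal.toReal_mul,
          ENNReal.toReal_ofReal (by norm_num : (0 : ℝ) ≤ 1 / 2)] at h
      have h2 : 1 / 2 * (μ A).toReal ≤ (μ (A ∩ G)).toReal := by linarith
      calc ENNReal.ofReal (1 / 2) * μ A = ENNReal.ofReal (1 / 2 * (μ A).toReal) := by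
            rw [ENNReal.ofReal_mul (by norm_num : (0 : ℝ) ≤ 1 / 2), ENNReal.ofReal_toReal hfinA]
        _ ≤ ENNReal.ofReal (μ (A ∩ G)).toReal := ENNReal.ofReal_le_ofReal h2
        _ = μ (A ∩ G) := ENNReal.ofReal_toReal hfinAG
    -- the good part above the stopping level lies inside the target event
    have hAG : A ∩ G ⊆ descendTo F ℰp J K hJK ⁻¹' B ∩ histGood F ℰp θf K J := by
      rintro U ⟨hUA, hUG⟩
      have hUA' : descendTo F ℰp (J + k₀) K hk U ∈ B'' := hUA
      have hUJ : descendTo F ℰp J K hJK U ∈ B := by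
        have h0 := hUA'.1
        rwa [descendTo_descendTo F ℰp (Nat.le_add_right J k₀) hk U] at h0
      refine ⟨hUJ, ?_⟩
      rw [mem_histGood_iff_descendTo]
      rw [hG, mem_histGood_iff_descendTo] at hUG
      intro j hJj hjK
      rcases Nat.eq_or_lt_of_le hJj with hEq | hlt
      · subst hEq
        exact hcf _ _ (hBW hUJ)
      · by_cases hjk : j ≤ J + k₀
        · have h2 := hUA'.2 j hlt hjk
          rw [descendTo_descendTo F ℰp hjk hk U] at h2
          exact hcf _ _ h2
        · exact hUG j (by omega) hjK
    calc ENNReal.ofReal (Q / 2) * μ (descendTo F ℰp J K hJK ⁻¹' B)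
        = ENNReal.ofReal (1 / 2) * (ENNReal.ofReal Q * μ (descendTo F ℰp J K hJK ⁻¹' B)) := by
          rw [← mul_assoc, ← ENNReal.ofReal_mul (by norm_num : (0 : ℝ) ≤ 1 / 2)]; congr 1; ring_nf
      _ ≤ ENNReal.ofReal (1 / 2) * μ {U | descendTo F ℰp J K hJK U ∈ B ∧
            ∀ j, J < j → j ≤ J + k₀ → ∀ hjK : j ≤ K, PlaqSmall (θc j) (descendTo F ℰp j K hjK U)} := mul_le_mul' le_rfl h1
      _ = ENNReal.ofReal (1 / 2) * μ A := by rw [hEk]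
      _ ≤ μ (A ∩ G) := hhalf
      _ ≤ μ (descendTo F ℰp J K hJK ⁻¹' B ∩ histGood F ℰp θf K J) := measure_mono hAG

end Assembly

/-! ## §6 THE STUBS (3: MSTEP₁∘ and DEEPSTEP∘ shared with LINE g22-1, PERS₁∘ new) and the by-name concluder -/

/-- STUB (shared with LINE g22-1) · MSTEP₁∘. -/
theorem stub_oneStepTailIntCan : OneStepTailIntCan := by
  sorry

/-- STUB (shared with LINE g22-1) · DEEPSTEP∘. -/
theorem stub_deepStepTailIntCan : DeepStepTailIntCan := by
  sorry

/-- STUB (NEW) · PERS₁∘. -/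
theorem stub_oneLevelPersistenceIntCan : OneLevelPersistenceIntCan := by
  sorry

/-- ★ THE BY-NAME CONCLUDER: POS∘ `GoodHistoryPositiveIntCan` (LINE g22-1's stub, text byte-identical) from the three stubs. -/
theorem goodHistoryPositiveIntCan_of_stubs : GoodHistoryPositiveIntCan :=
  goodHistoryPositiveInt_of_persistence_multiStep stub_oneLevelPersistenceIntCan
    (multiStepTail_of_oneStep_deepStep stub_oneStepTailIntCan stub_deepStepTailIntCan)

end Summit.QuantumFields.YangMills.Cruxes.FluctuationComparisonRegPrIntL.RunPairOrgan.PersistenceFloor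

end
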